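import Mathlib
import HarnessLib
import Summits.Langlands.Langlands.Theses.QuadraticWindow
import Literature.NumberTheory.Automorphic.UnitaryCoherentGaloisRep

/-!
# Sketch (crux-ideate, ideator 2, round 1): first lemmas of the two idea cards for the crux
`Summit.Langlands.Langlands.Theses.QuadraticWindow.GaloisRepOfUnitaryLDS`
(= `Literature.NumberTheory.Automorphic.GoldringKoskivirta2019_galoisRep_unitary` verbatim).

* Card A `hecke-algebra-valued-limit`: `exists_semisimple_galoisRep_of_algebraValuedApprox`
  (THE LEVER: Galois socket consuming Hecke-ALGEBRA-valued congruences, faithful to GK19 Thm 3.4.1 +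
  Thm 3.5.6 + §11.1) and the transfer statement `RegularShadows` (automorphic side: factorisation of
  the mod-`ℓ^m` eigensystem of `σ` through finitely many REGULAR discrete-series cusp forms).
* Card B `higher-coleman-accumulation`: `SingleRegularApproximants` (BP21 Thm 6.9/339 (1)+(2)+(4):
  single regular approximants at all good places) feeding the EXISTING proved socket
  `GoldringKoskivirta2019_galoisRep_unitary_of_ladicApprox`.
* Shared stubs both lines need: `RegularDSGalois` (the crux for REGULAR discrete series = HLTT
  Cor. 1.3 / CHL–Shin–Labesse), `SatakePolyUnique`, `HeckeFieldFinite`, `AlmostAllUnramified`.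

Nothing here is proved (`sorry`); the file only certifies that the signatures elaborate.
-/

noncomputable section

open scoped BigOperators Polynomial Classical NumberField
open Polynomial IsDedekindDomain NumberField Filter
open Literature.NumberTheory.Automorphic Literature.NumberTheory.GaloisRepresentations

set_option linter.dupNamespace false

namespace Summit.Langlands.Langlands.Cruxes.GaloisRepOfUnitaryLDS.SketchIdeator2

/-! ## Card A — the lever: an algebra-valued `ℓ`-adic limit theorem (pure Galois/valuation theory) -/

/-- **Card A, first lemma (the lever).**  Taylor 1991 / GK19 §11.1 in its FAITHFUL,
Hecke-algebra-valued form: instead of one approximating representation per precision `m`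
(`exists_semisimple_galoisRep_of_ladicLimit`), a FINITE FAMILY `ρ'_i` per `m` and the
*approximate factorisation inequality*: every integer polynomial `F` in the Frobenius-coefficient
variables `(v, k)` at good places satisfies `‖F(P)‖ ≤ max(ℓ^{-m}, C · sup_i ‖F(charpoly ρ'_i)‖)` —
i.e. the prescribed system `v ↦ P_v` modulo `ℓ^m` factors continuously through the closed
`ℤ_ℓ`-algebra generated by the Frobenius characteristic polynomials of the `ρ'_i` (the regular-weight
Hecke algebra `T`, with `C = ℓ^{e+1}`, `ℓ^e` killing `T̃/T`).  Conclusion as in the single-approximant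
theorem.  Proof plan (in-tree tools): Chebotarev density (`absoluteGaloisGroup.frobenius_dense`) +
the inequality give well-defined locally constant `t_m^{(k)} : Γ_K → 𝒪_E / {‖·‖ ≤ ℓ^{-m}}`; limit
`T^{(k)} : Γ_K → E`; the Frobenius identity and Newton's identities are INTEGER polynomial identities,
hence pass through the inequality; `IsPseudocharacter.of_tendsto`, Taylor
(`BellaicheChenevier2009_continuous_rep_of_pseudocharacter_holds`), `multiset_eq_of_psum_eq`,
`apply_eq_one_of_mem_charpolyKer`. -/
theorem exists_semisimple_galoisRep_of_algebraValuedApprox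
    (K : Type) [Field K] [NumberField K] (N : ℕ) {ℓ : ℕ} [Fact ℓ.Prime]
    (E : IntermediateField ℚ_[ℓ] (PadicAlgCl ℓ)) [FiniteDimensional ℚ_[ℓ] E]
    (S : Set (HeightOneSpectrum (𝓞 K))) (hS : S.Finite)
    (P : HeightOneSpectrum (𝓞 K) → (PadicAlgCl ℓ)[X])
    (hP : ∀ v ∉ S, ∀ k : ℕ, (P v).coeff k ∈ E)
    (happrox : ∀ m : ℕ, ∃ (r : ℕ) (ρ' : Fin r → FramedGaloisRep K (PadicAlgCl ℓ) N)
        (Q : Fin r → HeightOneSpectrum (𝓞 K) → (PadicAlgCl ℓ)[X]) (C : ℝ),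
        (∀ i, ∀ v ∉ S, ((ℓ : ℕ) : 𝓞 K) ∉ v.asIdeal →
          (ρ' i).IsUnramifiedAt v ∧ (ρ' i).HasFrobCharpolyAt v (Q i v)) ∧
        ∀ (F : MvPolynomial (HeightOneSpectrum (𝓞 K) × ℕ) ℤ) (b : ℝ),
          (∀ vk ∈ F.vars, vk.1 ∉ S ∧ ((ℓ : ℕ) : 𝓞 K) ∉ vk.1.asIdeal) →
          (∀ i, ‖MvPolynomial.aeval
              (fun vk : HeightOneSpectrum (𝓞 K) × ℕ => (Q i vk.1).coeff vk.2) F‖ ≤ b) →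
            ‖MvPolynomial.aeval
                (fun vk : HeightOneSpectrum (𝓞 K) × ℕ => (P vk.1).coeff vk.2) F‖ ≤
              max ((ℓ : ℝ) ^ (-(m : ℤ))) (C * b)) :
    ∃ ρ : FramedGaloisRep K (PadicAlgCl ℓ) N, ρ.toGaloisRep.IsSemisimple ∧
      ∀ v ∉ S, ((ℓ : ℕ) : 𝓞 K) ∉ v.asIdeal → ρ.IsUnramifiedAt v ∧ ρ.HasFrobCharpolyAt v (P v) := by
  sorry

/-- Sanity: the single-approximant hypothesis of the in-tree socket is the case `r = 1`, `C = 1` of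
the algebra-valued one (one representation, `F(P)` within `ℓ^{-m}`… — recorded as a statement only;
the easy direction "exact family ⇒ inequality" is what makes `RegularShadows` a consequence of the
crux, i.e. not stronger than it). -/
theorem algebraValued_of_single {ℓ : ℕ} [Fact ℓ.Prime] (x p : PadicAlgCl ℓ) (m : ℕ)
    (h : ‖p - x‖ ≤ (ℓ : ℝ) ^ (-(m : ℤ))) (b : ℝ) (hb : ‖x‖ ≤ b) :
    ‖p‖ ≤ max ((ℓ : ℝ) ^ (-(m : ℤ))) (1 * b) := by
  have := IsUltrametricDist.norm_add_le_max (p - x) x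
  simp only [sub_add_cancel, one_mul] at this ⊢
  exact this.trans (max_le_max h hb)

/-! ## The crux's data, abbreviated -/

section CruxData

variable (F₀ K : Type) [Field F₀] [NumberField F₀] [Field K] [NumberField K] [Algebra F₀ K]
  (cK : K ≃ₐ[F₀] K) (N : ℕ) (ℓ : ℕ) [Fact ℓ.Prime]
  (hcptK : isCompact_glFiniteIntegralLevel N K)

/-- The GOOD places of the crux's conclusion for `σ`: `u ∤ ℓ`, over a rational prime `p` such that
every `u' ∣ p` is unramified over `ℚ` and `σ` is unramified at `u'` (GK's `p ∉ Ram(G) ∪ Ram(σ)`,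
indexed by rational primes — Cruxes/HostInducedRep/Disproof.lean §6). -/
def Good (σ : UnitaryGroup.CuspidalAutomorphicRepData F₀ K cK N hcptK)
    (u : HeightOneSpectrum (𝓞 K)) : Prop :=
  ((ℓ : ℕ) : 𝓞 K) ∉ u.asIdeal ∧
    ∀ u' : HeightOneSpectrum (𝓞 K), u'.asIdeal.under ℤ = u.asIdeal.under ℤ →
      u'.asIdeal.ramificationIdx ℤ = 1 ∧ UnitaryGroup.IsUnramifiedAt F₀ K cK N hcptK σ.1 u'

/-- `σ` has a non-degenerate limit of discrete series at every real place (the crux's archimedean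
hypothesis, verbatim). -/
def NDLDSAtInfinity (hc : cK ≠ 1) (σ : UnitaryGroup.CuspidalAutomorphicRepData F₀ K cK N hcptK) :
    Prop :=
  ∀ (w : {w : InfinitePlace K // w.IsComplex}) (hw : cK • w.1 = w.1),
    ∃ (p q : ℕ) (d : LDSDatum p q),
      UnitaryGroup.IsNondegenerateLimitOfDiscreteSeriesAt F₀ K cK N (StdForm.antidiagonal N)
        hcptK σ.1 hw hc d

/-- `σ` has a REGULAR (genuine) discrete series at every real place (`LDSDatum.IsRegular`; discrete
series are included in the tree's LDS data). -/
def DSAtInfinity (hc : cK ≠ 1) (σ : UnitaryGroup.CuspidalAutomorphicRepData F₀ K cK N hcptK) :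
    Prop :=
  ∀ (w : {w : InfinitePlace K // w.IsComplex}) (hw : cK • w.1 = w.1),
    ∃ (p q : ℕ) (d : LDSDatum p q), d.IsRegular ∧
      UnitaryGroup.IsNondegenerateLimitOfDiscreteSeriesAt F₀ K cK N (StdForm.antidiagonal N)
        hcptK σ.1 hw hc d

/-- The predicted arithmetic-Frobenius polynomial coefficient at the variable `(u, k)` for a
selection `β₀` of base-change Satake parameters. -/
def predCoeff (ι : PadicAlgCl ℓ ≃+* ℂ) (β₀ : HeightOneSpectrum (𝓞 K) → Multiset ℂ)
    (uk : HeightOneSpectrum (𝓞 K) × ℕ) : PadicAlgCl ℓ :=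
  (arithFrobPolyOfSatake ι uk.1.residueCard N (β₀ uk.1)).coeff uk.2

end CruxData

/-! ## Shared stubs (both lines) -/

/-- **Shared stub 1 (local, Satake multiplicity one for the base-change polynomial).**  Two
base-change Satake parameters of `σ` at a good place give the same predicted polynomial (the
crux CONSUMES this: its conclusion quantifies over every `β`).  Cartier 1979 §IV + Mínguez 2011
Thm 4.1 (Satake isomorphism for hyperspecial `U(N)`; `dim σ_u^{K_u} = 1`). -/
def SatakePolyUnique : Prop :=
  ∀ (F₀ K : Type) [Field F₀] [NumberField F₀] [Field K] [NumberField K] [Algebra F₀ K]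
    (cK : K ≃ₐ[F₀] K), IsTotallyReal F₀ → Module.finrank F₀ K = 2 → cK ≠ 1 →
    ∀ (N ℓ : ℕ) [Fact ℓ.Prime] (ι : PadicAlgCl ℓ ≃+* ℂ)
    (hcptK : isCompact_glFiniteIntegralLevel N K)
    (σ : UnitaryGroup.CuspidalAutomorphicRepData F₀ K cK N hcptK)
    (u : HeightOneSpectrum (𝓞 K)) (β β' : Multiset ℂ), Good F₀ K cK N ℓ hcptK σ u →
      UnitaryGroup.HasBaseChangeSatakeAt F₀ K cK N hcptK σ.1 u β →
      UnitaryGroup.HasBaseChangeSatakeAt F₀ K cK N hcptK σ.1 u β' →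
        arithFrobPolyOfSatake ι u.residueCard N β = arithFrobPolyOfSatake ι u.residueCard N β'

/-- **Shared stub 2 (rationality: the Hecke field of `σ` is a number field, hence `ℓ`-adically
finite).**  GK19 §2.2 Cor 2.2.2 (coherent cohomology has a rational structure, Harris 1990): the
predicted polynomials at good places have coefficients in ONE finite `E/ℚ_ℓ`. -/
def HeckeFieldFinite : Prop :=
  ∀ (F₀ K : Type) [Field F₀] [NumberField F₀] [Field K] [NumberField K] [Algebra F₀ K]
    (cK : K ≃ₐ[F₀] K) (hc : cK ≠ 1), IsTotallyReal F₀ → Module.finrank F₀ K = 2 →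
    ∀ (N ℓ : ℕ) [Fact ℓ.Prime] (ι : PadicAlgCl ℓ ≃+* ℂ)
    (hcptK : isCompact_glFiniteIntegralLevel N K)
    (σ : UnitaryGroup.CuspidalAutomorphicRepData F₀ K cK N hcptK),
    NDLDSAtInfinity F₀ K cK N hcptK hc σ →
      ∃ (E : IntermediateField ℚ_[ℓ] (PadicAlgCl ℓ)), FiniteDimensional ℚ_[ℓ] E ∧
        ∀ (u : HeightOneSpectrum (𝓞 K)) (β : Multiset ℂ), Good F₀ K cK N ℓ hcptK σ u →
          UnitaryGroup.HasBaseChangeSatakeAt F₀ K cK N hcptK σ.1 u β →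
            ∀ k : ℕ, (arithFrobPolyOfSatake ι u.residueCard N β).coeff k ∈ E

/-- **Shared stub 3 (Flath: almost every place is good).**  The complement of the good set is
finite (places over `ℓ`, over primes ramified in `K`, and over primes where `σ` ramifies). -/
def AlmostAllUnramified : Prop :=
  ∀ (F₀ K : Type) [Field F₀] [NumberField F₀] [Field K] [NumberField K] [Algebra F₀ K]
    (cK : K ≃ₐ[F₀] K), IsTotallyReal F₀ → Module.finrank F₀ K = 2 → cK ≠ 1 →
    ∀ (N ℓ : ℕ) [Fact ℓ.Prime] (hcptK : isCompact_glFiniteIntegralLevel N K)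
    (σ : UnitaryGroup.CuspidalAutomorphicRepData F₀ K cK N hcptK),
      {u : HeightOneSpectrum (𝓞 K) | ¬ Good F₀ K cK N ℓ hcptK σ u}.Finite

/-- **Shared stub 4 (the REGULAR case of the crux, no hypothesis at `ℓ` on `σ'`): Galois
representations for cuspidal `σ'` on `U_{K/F₀}(N)` with regular discrete series at every real
place, with the predicted polynomial at every good place of `σ'`.**  HLTT 2016 Cor 1.3 (= Shin 2011
+ Labesse base change + CHL), as used in GK19 §11.1 Rem 11.1.1; the `U → GU` passage of
Fakhruddin–Pilloni Thm 9.11.  Known theorem, `lang.S27`-class. -/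
def RegularDSGalois : Prop :=
  ∀ (F₀ K : Type) [Field F₀] [NumberField F₀] [Field K] [NumberField K] [Algebra F₀ K]
    (cK : K ≃ₐ[F₀] K) (hc : cK ≠ 1), IsTotallyReal F₀ → Module.finrank F₀ K = 2 →
    IsTotallyComplex K → ∀ (N ℓ : ℕ) [Fact ℓ.Prime] (ι : PadicAlgCl ℓ ≃+* ℂ)
    (hcptK : isCompact_glFiniteIntegralLevel N K)
    (σ' : UnitaryGroup.CuspidalAutomorphicRepData F₀ K cK N hcptK),
    DSAtInfinity F₀ K cK N hcptK hc σ' →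
      ∃ r : FramedGaloisRep K (PadicAlgCl ℓ) N, r.toGaloisRep.IsSemisimple ∧
        ∀ (u : HeightOneSpectrum (𝓞 K)) (β : Multiset ℂ), Good F₀ K cK N ℓ hcptK σ' u →
          UnitaryGroup.HasBaseChangeSatakeAt F₀ K cK N hcptK σ'.1 u β →
            r.IsUnramifiedAt u ∧ r.HasFrobCharpolyAt u (arithFrobPolyOfSatake ι u.residueCard N β)

/-! ## Card A — transfer statement `C⁺` (automorphic side, engine GK19 Thm 3.4.1 / PS16) -/

/-- **Card A, transfer `C⁺ = RegularShadows` (Hecke-algebra-valued congruence to regular forms).**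
For `σ` as in the crux, a selection `β₀` of its base-change Satake parameters at the good places,
and every precision `m`, there are finitely many cuspidal `σ_j` on the SAME group `U_{K/F₀}(N)` with
REGULAR discrete series at infinity, good wherever `σ` is good, with Satake selections `β_j`, and a
constant `C`, such that every integer polynomial relation among the predicted Frobenius coefficients
that is `b`-small on all the `σ_j` is `max(ℓ^{-m}, C b)`-small on `σ`: the eigensystem of `σ` modulo
`ℓ^m` factors through the `ℤ_ℓ`-Hecke algebra of the `σ_j` (GK19 Thm 3.4.1 "reduction to `H^0`" +
torsion-freeness of `H^0` in very regular weight (Lan–Suh) ; or Pilloni–Stroh 2016).  Purely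
automorphic: no Galois representation, no pseudocharacter, no limit. -/
def RegularShadows : Prop :=
  ∀ (F₀ K : Type) [Field F₀] [NumberField F₀] [Field K] [NumberField K] [Algebra F₀ K]
    (cK : K ≃ₐ[F₀] K) (hc : cK ≠ 1), IsTotallyReal F₀ → Module.finrank F₀ K = 2 →
    IsTotallyComplex K → ∀ (N ℓ : ℕ) [Fact ℓ.Prime] (ι : PadicAlgCl ℓ ≃+* ℂ)
    (hcptK : isCompact_glFiniteIntegralLevel N K)
    (σ : UnitaryGroup.CuspidalAutomorphicRepData F₀ K cK N hcptK),
    NDLDSAtInfinity F₀ K cK N hcptK hc σ →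
    (∀ u : HeightOneSpectrum (𝓞 K), ((ℓ : ℕ) : 𝓞 K) ∈ u.asIdeal →
      u.asIdeal.ramificationIdx ℤ = 1 ∧ UnitaryGroup.IsUnramifiedAt F₀ K cK N hcptK σ.1 u) →
    ∀ (β₀ : HeightOneSpectrum (𝓞 K) → Multiset ℂ),
      (∀ u, Good F₀ K cK N ℓ hcptK σ u → UnitaryGroup.HasBaseChangeSatakeAt F₀ K cK N hcptK σ.1 u (β₀ u)) →
      ∀ m : ℕ, ∃ (r : ℕ) (σ' : Fin r → UnitaryGroup.CuspidalAutomorphicRepData F₀ K cK N hcptK)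
        (β' : Fin r → HeightOneSpectrum (𝓞 K) → Multiset ℂ) (C : ℝ),
        (∀ j, DSAtInfinity F₀ K cK N hcptK hc (σ' j) ∧
          ∀ u, Good F₀ K cK N ℓ hcptK σ u → Good F₀ K cK N ℓ hcptK (σ' j) u ∧
            UnitaryGroup.HasBaseChangeSatakeAt F₀ K cK N hcptK (σ' j).1 u (β' j u)) ∧
        ∀ (Φ : MvPolynomial (HeightOneSpectrum (𝓞 K) × ℕ) ℤ) (b : ℝ),
          (∀ uk ∈ Φ.vars, Good F₀ K cK N ℓ hcptK σ uk.1) →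
          (∀ j, ‖MvPolynomial.aeval (predCoeff K N ℓ ι (β' j)) Φ‖ ≤ b) →
            ‖MvPolynomial.aeval (predCoeff K N ℓ ι β₀) Φ‖ ≤ max ((ℓ : ℝ) ^ (-(m : ℤ))) (C * b)

/-- **Card A, composition (shape of the future skeleton; to be PROVED by the line from
`exists_semisimple_galoisRep_of_algebraValuedApprox`).** -/
theorem GaloisRepOfUnitaryLDS_of_regularShadows
    (h₁ : SatakePolyUnique) (h₂ : HeckeFieldFinite) (h₃ : AlmostAllUnramified)
    (h₄ : RegularDSGalois) (h₅ : RegularShadows) :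
    Summit.Langlands.Langlands.Theses.QuadraticWindow.GaloisRepOfUnitaryLDS := by
  sorry

/-! ## Card B — transfer statement `C⁺` (automorphic side, engine BP21 Thm 339 (1)(2)(4)) -/

/-- **Card B, transfer `C⁺ = SingleRegularApproximants` (eigenvariety accumulation).**  For `σ` as
in the crux, a Satake selection `β₀` and every `m`, ONE cuspidal `σ'` on `U_{K/F₀}(N)` with regular
discrete series at infinity, good wherever `σ` is good (no condition above `ℓ`: `σ'` is of finite
slope / Iwahori level there), whose predicted Frobenius polynomials at all good places are within
`ℓ^{-m}` of those of `σ`, coefficientwise under `ι⁻¹`.  Boxer–Pilloni 2021, Thm 339: (1) `σ` gives a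
point `x_σ` of the coherent eigenvariety, (4) on a component of dimension `dim 𝒲`, (2) regular
small-slope locally algebraic points are classical; accumulation at `x_σ` along an idempotent
neighbourhood gives the congruences (precision loss bounded independently of `m`). -/
def SingleRegularApproximants : Prop :=
  ∀ (F₀ K : Type) [Field F₀] [NumberField F₀] [Field K] [NumberField K] [Algebra F₀ K]
    (cK : K ≃ₐ[F₀] K) (hc : cK ≠ 1), IsTotallyReal F₀ → Module.finrank F₀ K = 2 →
    IsTotallyComplex K → ∀ (N ℓ : ℕ) [Fact ℓ.Prime] (ι : PadicAlgCl ℓ ≃+* ℂ)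
    (hcptK : isCompact_glFiniteIntegralLevel N K)
    (σ : UnitaryGroup.CuspidalAutomorphicRepData F₀ K cK N hcptK),
    NDLDSAtInfinity F₀ K cK N hcptK hc σ →
    (∀ u : HeightOneSpectrum (𝓞 K), ((ℓ : ℕ) : 𝓞 K) ∈ u.asIdeal →
      u.asIdeal.ramificationIdx ℤ = 1 ∧ UnitaryGroup.IsUnramifiedAt F₀ K cK N hcptK σ.1 u) →
    ∀ (β₀ : HeightOneSpectrum (𝓞 K) → Multiset ℂ),
      (∀ u, Good F₀ K cK N ℓ hcptK σ u → UnitaryGroup.HasBaseChangeSatakeAt F₀ K cK N hcptK σ.1 u (β₀ u)) →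
      ∀ m : ℕ, ∃ (σ' : UnitaryGroup.CuspidalAutomorphicRepData F₀ K cK N hcptK)
        (β' : HeightOneSpectrum (𝓞 K) → Multiset ℂ),
        DSAtInfinity F₀ K cK N hcptK hc σ' ∧
        ∀ u, Good F₀ K cK N ℓ hcptK σ u → Good F₀ K cK N ℓ hcptK σ' u ∧
          UnitaryGroup.HasBaseChangeSatakeAt F₀ K cK N hcptK σ'.1 u (β' u) ∧
          ∀ k : ℕ, ‖predCoeff K N ℓ ι β' (u, k) - predCoeff K N ℓ ι β₀ (u, k)‖ ≤ (ℓ : ℝ) ^ (-(m : ℤ))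

/-- **Card B, composition (shape of the future skeleton; to be PROVED by the line from the in-tree
`GoldringKoskivirta2019_galoisRep_unitary_of_ladicApprox`).** -/
theorem GaloisRepOfUnitaryLDS_of_singleRegularApproximants
    (h₁ : SatakePolyUnique) (h₂ : HeckeFieldFinite) (h₃ : AlmostAllUnramified)
    (h₄ : RegularDSGalois) (h₅ : SingleRegularApproximants) :
    Summit.Langlands.Langlands.Theses.QuadraticWindow.GaloisRepOfUnitaryLDS := by
  sorry

/-- The crux is the named fact, verbatim. -/
example : Summit.Langlands.Langlands.Theses.QuadraticWindow.GaloisRepOfUnitaryLDS ↔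
    GoldringKoskivirta2019_galoisRep_unitary := Iff.rfl

end Summit.Langlands.Langlands.Cruxes.GaloisRepOfUnitaryLDS.SketchIdeator2

end
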